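import Literature.NumberTheory.Irrationality.RhinViola2001.TheoremTwoOneArithmetic
import Literature.NumberTheory.Irrationality.RhinViola2001.TheoremTwoOneAnalysis
import HarnessLib

/-!
# Rhin–Viola 2001, Theorem 2.1 — PROVED (`theorem21_holds`)

Topic `Literature/NumberTheory/Irrationality/RhinViola2001`. Literature-side DISCHARGE (cell `pub-zeta5`, seat denom-lit g45,
2026-08-27) of the named fact `theorem21` of `GroupStructure.lean`: G. Rhin, C. Viola, *The group structure for ζ(3)*,
Acta Arith. **97** (2001) 269–293 [RhinViola2001], Theorem 2.1 (pp. 273–274), proof pp. 274–275 (held text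
`paper:doi-10-4064-aa97-3-6`, pp. 271–276 read on the page by this seat):

  "Let `h, j, k, l, m, q, r, s` be non-negative integers satisfying `h + m = k + r` and `j + q = l + s`. Let `S` denote the
  sequence of the integers (2.8) … `M = max S`, `N = max′ S`, `Q = max″ S`. Then the integral `I = I(h,j,k,l,m,q,r,s)` …
  satisfies (2.9) `I = a + 2bζ(3)`, with `d_M d_N d_Q a ∈ ℤ` and `b ∈ ℤ`."

HONEST FRAMING (cell pub-zeta5): systematic search; no irrationality claim unless certified. A 2001 theorem on the
arithmetic of a family of `ζ(3)`-integrals, typed-and-proved; nothing here concerns `ζ(5)`.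

## The printed proof and this formalisation

The proof is followed verbatim, as a strong induction on `h + j + ⋯ + s` (= the sum of the integers (2.8),
`TheoremTwoOne.aux_toList_sum`), the induction step being `TheoremTwoOne.step`:
* some integer (2.8) is negative ⇒ a power of `ϑ` puts a negative integer in the slot `q' = q+h−r`
  (`exists_theta_iter_aux_q_neg`; `I` and `d_M d_N d_Q` are `ϑ`-invariant: `I_theta_iter` from the tree's
  `ThetaInvariance.I_theta`, `denomS_theta_iter`), and then "`I` is the integral of a polynomial in `x, y, z` with integer
  coefficients and partial degrees `r+l−q−1`, `m+s−q−1`, `j+r−h−1`. Therefore `d_{r+l−q} d_{m+s−q} d_{j+r−h} I ∈ ℤ`"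
  (`I_polynomial_case`) and these three "occur in distinct places in the list (2.8)" (`d_slots_dvd_denomS`);
* all (2.8) non-negative and, after a power of `ϑ`, `lmqr > 0` ⇒ the linear decomposition (2.10) (`I_decomp`) into three
  balanced non-negative tuples of smaller sum whose (2.8) are pointwise `≤` (`decomp_one/two/three`,
  `prod_d_succMax_dvd_of_forall₂`), "Thus if Theorem 2.1 holds for the three integrals, it also holds for `I`"
  (`concl_of_decomp`);
* otherwise the tuple is, up to a power of `ϑ`, `(h,0,h,0,h,0,h,0)` (`terminal`, both printed sub-cases), and (2.11)
  `I(h,0,h,0,h,0,h,0) = ∫∫ −log(xy)/(1−xy) x^h y^h dx dy = −2Σ_{ν=1}^{h} ν^{−3} + 2ζ(3)` "by Lemma 1 of [Beukers]"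
  (`I_star`, from the tree's `Beukers.logKernelIntegral_diag_holds`), with `d_h³ ∣ d_M d_N d_Q` (`d_cube_dvd_denomS_star`).
Theorems only; no definition, no new named fact (net debt −1).

## References
* [RhinViola2001] G. Rhin, C. Viola, The group structure for ζ(3), Acta Arith. 97 (2001) 269–293, doi:10.4064/aa97-3-6,
  Theorem 2.1 and its proof, pp. 273–275.
* [Beukers1979] F. Beukers, A note on the irrationality of ζ(2) and ζ(3), Bull. London Math. Soc. 11 (1979) 268–272,
  Lemma 1 (the base case (2.11)).
-/

noncomputable section

namespace Literature.NumberTheory.Irrationality.RhinViola2001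

open Literature.NumberTheory.Transcendental (zetaValue)

namespace TheoremTwoOne

/-- Non-negative parameters are natural numbers. [cite: RhinViola2001, Theorem 2.1] -/
theorem exists_nat_of_nonneg {P : Params} (hN : P.Nonneg) :
    ∃ h j k l m q r s : ℕ, P = ⟨h, j, k, l, m, q, r, s⟩ := by
  obtain ⟨h0, h1, h2, h3, h4, h5, h6, h7⟩ := hN
  refine ⟨P.h.toNat, P.j.toNat, P.k.toNat, P.l.toNat, P.m.toNat, P.q.toNat, P.r.toNat, P.s.toNat, ?_⟩
  ext <;> simp only [Int.toNat_of_nonneg, *]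

/-- The sum `h + ⋯ + s` of non-negative parameters is non-negative. [cite: RhinViola2001, Theorem 2.1] -/
theorem toList_sum_nonneg {P : Params} (hN : P.Nonneg) : 0 ≤ P.toList.sum := by
  obtain ⟨_, _, _, _, _, _, _, _⟩ := hN
  rw [toList_sum]; omega

/-- `d_n` at a natural number. [cite: RhinViola2001, §2 p. 271] -/
theorem d_natCast (n : ℕ) : d n = Nat.lcmUpto n := by simp [d]

/-- **The induction step of the printed proof of Theorem 2.1**: if (2.9) holds for all non-negative balanced tuples
with smaller `h + ⋯ + s`, it holds for `P`. Cases: some integer (2.8) negative (a power of `ϑ`, then the polynomial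
case); all (2.8) non-negative and some `ϑ`-rotate has `lmqr > 0` (the decomposition (2.10)); the terminal tuples
((2.11)). [cite: RhinViola2001, Theorem 2.1 (proof, pp. 274–275)] -/
theorem step {P : Params} (hN : P.Nonneg) (hB : P.Balanced)
    (ih : ∀ Q : Params, Q.Nonneg → Q.Balanced → Q.toList.sum < P.toList.sum →
      ∃ (a : ℚ) (b : ℤ), I Q = a + 2 * b * zetaValue 3 ∧ ∃ A : ℤ, (denomS Q : ℚ) * a = A) :
    ∃ (a : ℚ) (b : ℤ), I P = a + 2 * b * zetaValue 3 ∧ ∃ A : ℤ, (denomS P : ℚ) * a = A := by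
  by_cases hA : P.aux.Nonneg
  · by_cases hW : ∃ i < 8, 0 < (theta^[i] P).l ∧ 0 < (theta^[i] P).m ∧ 0 < (theta^[i] P).q ∧ 0 < (theta^[i] P).r
    · -- the linear decomposition (2.10), after a power of `ϑ`
      obtain ⟨i, -, hw⟩ := hW
      have hN' := nonneg_theta_iter hN i
      have hB' := balanced_theta_iter hB i
      have hsum' : (theta^[i] P).toList.sum = P.toList.sum := toList_sum_theta_iter P i
      refine concl_of_eq (I_theta_iter hB i).symm (denomS_theta_iter P i).symm ?_
      obtain ⟨n1, b1, s1, d1⟩ := decomp_one hN' hB' hw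
      obtain ⟨n2, b2, s2, d2⟩ := decomp_two hN' hB' hw
      obtain ⟨n3, b3, s3, d3⟩ := decomp_three hN' hB' hw
      refine concl_of_decomp ?_ d1 d2 d3 (ih _ n1 b1 (by omega)) (ih _ n2 b2 (by omega)) (ih _ n3 b3 (by omega))
      obtain ⟨h, j, k, l, m, q, r, s, hP⟩ := exists_nat_of_nonneg hN'
      rw [hP] at hw hB'
      simp only [Params.Balanced] at hw hB'
      obtain ⟨l, rfl⟩ : ∃ l₀, l = l₀ + 1 := ⟨l - 1, by omega⟩
      obtain ⟨m, rfl⟩ : ∃ m₀, m = m₀ + 1 := ⟨m - 1, by omega⟩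
      obtain ⟨q, rfl⟩ : ∃ q₀, q = q₀ + 1 := ⟨q - 1, by omega⟩
      obtain ⟨r, rfl⟩ : ∃ r₀, r = r₀ + 1 := ⟨r - 1, by omega⟩
      have key := I_decomp h j k l m q r s (by omega)
      rw [hP]
      push_cast
      simp only [add_sub_cancel_right]
      exact key
    · -- the terminal tuples
      obtain ⟨t, ht, n, hn⟩ := terminal hN hB hA fun i hi hc => hW ⟨i, hi, hc⟩
      obtain ⟨t, rfl⟩ := Int.eq_ofNat_of_zero_le ht
      refine concl_of_eq (I_theta_iter hB n).symm (denomS_theta_iter P n).symm ?_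
      rw [hn]
      exact concl_of_star (I_star t) (d_cube_dvd_denomS_star t)
  · -- the polynomial case, after a power of `ϑ`
    obtain ⟨i, hi⟩ := exists_theta_iter_aux_q_neg hA
    refine concl_of_eq (I_theta_iter hB i).symm (denomS_theta_iter P i).symm ?_
    obtain ⟨h, j, k, l, m, q, r, s, hP⟩ := exists_nat_of_nonneg (nonneg_theta_iter hN i)
    have hB' := balanced_theta_iter hB i
    rw [hP] at hi hB' ⊢
    simp only [Params.aux, Params.Balanced] at hi hB'
    obtain ⟨e, rfl⟩ : ∃ e : ℕ, r = q + h + e + 1 := ⟨r - (q + h + 1), by omega⟩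
    obtain ⟨ρ, hρ, hz⟩ := I_polynomial_case h j k l m q s e
    have hslots := d_slots_dvd_denomS ⟨h, j, k, l, m, q, (q + h + e + 1 : ℕ), s⟩
    have er : (⟨h, j, k, l, m, q, (q + h + e + 1 : ℕ), s⟩ : Params).aux.r = ((h + l + e + 1 : ℕ) : ℤ) := by
      simp only [Params.aux]; push_cast; omega
    have em : (⟨h, j, k, l, m, q, (q + h + e + 1 : ℕ), s⟩ : Params).aux.m = ((k + s + e + 1 : ℕ) : ℤ) := by
      simp only [Params.aux]; push_cast; omega
    have ej : (⟨h, j, k, l, m, q, (q + h + e + 1 : ℕ), s⟩ : Params).aux.j = ((j + q + e + 1 : ℕ) : ℤ) := by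
      simp only [Params.aux]; push_cast; omega
    rw [er, em, ej, d_natCast, d_natCast, d_natCast] at hslots
    exact concl_of_rat hρ hslots hz

/-- (2.9) for every non-negative balanced tuple, by strong induction on `h + j + ⋯ + s` ("in finitely many steps").
[cite: RhinViola2001, Theorem 2.1 (proof, p. 275)] -/
theorem concl_of_sum_le (n : ℕ) : ∀ P : Params, P.Nonneg → P.Balanced → P.toList.sum ≤ n →
    ∃ (a : ℚ) (b : ℤ), I P = a + 2 * b * zetaValue 3 ∧ ∃ A : ℤ, (denomS P : ℚ) * a = A := by
  induction n with
  | zero =>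
    intro P hN hB hs
    exact step hN hB fun Q hQN _ hlt => absurd (toList_sum_nonneg hQN) (by push_cast at hs; omega)
  | succ n ih =>
    intro P hN hB hs
    exact step hN hB fun Q hQN hQB hlt => ih Q hQN hQB (by push_cast at hs; omega)

end TheoremTwoOne

/-- **Rhin–Viola 2001, Theorem 2.1** — DISCHARGE of the named fact `theorem21`: for non-negative integers
`h, j, k, l, m, q, r, s` with `h + m = k + r` and `j + q = l + s`, `I(h,j,k,l,m,q,r,s) = a + 2bζ(3)` with `b ∈ ℤ`,
`a ∈ ℚ` and `d_M d_N d_Q a ∈ ℤ`, `M, N, Q` the three successive maxima of the integers (2.8).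
[cite: RhinViola2001, Theorem 2.1 (pp. 273–274), proof pp. 274–275] -/
theorem theorem21_holds : theorem21 := fun P hN hB =>
  TheoremTwoOne.concl_of_sum_le P.toList.sum.toNat P hN hB (Int.self_le_toNat _)

end Literature.NumberTheory.Irrationality.RhinViola2001

end
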